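import Summits.CriticalPhenomena.PercolationContinuityZ3.Theorems.PercNearOneGluingAdditiveGluingBlobTransfer
import Summits.CriticalPhenomena.PercolationContinuityZ3.Theorems.PercGamblersRuinBGNOffTheFloorBridges
import Literature.Probability.Percolation.PercolationEvents
import HarnessLib

/-! # Crux `PercNearOneGluing.AdditiveGluing` (stmt-CriticalPhenomena-4576) — observer-exploration LEAF SYSTEMS: the composition

Support file (`--supports stmt-CriticalPhenomena-4576`, cell `prim-png-dp-al5` gen 7; memo `EXPLORE-g7.md` §1–§3).  No `sorry`, no definitions.

A **leaf system** for `(w, A, o, b)` is a finite family of events `D i` ("leaves") with blobs `U i` and contact sets `B i`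
(all data explicit, nothing defined): the `D i` are pairwise disjoint and cover the configuration space; `U i` avoids `A` and `b`;
`D i` is determined by the pairs meeting `U i` and lies in STAR ∩ JOIN of the companion file (every open pair leaving `U i` ends in
`B i`; every vertex of `B i ∖ U i` is attached by an open pair to a blob vertex reached from `o`); and on a leaf whose contact set
misses `A ∪ {b}` the observer is not joined to `A`.  The BFS exploration of `o`'s blob through `V ∖ (A ∪ {b})` stopped at the first
contact (memo §1) is such a system; so is Kozma–Nitzan's star decomposition (`U i = {o}`, Thm. 4).

* `LeafSystem.preFKG_of_leafSystem` — **Theorem A of the memo**: if one relay `x̂ ∈ A` is ADMISSIBLE at every contact leaf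
  (`∃ v ∈ B i ∖ U i`, `μ(x̂ ↔ b in (U i)ᶜ) ≤ μ(v ↔ b in (U i)ᶜ)`), then Kozma–Nitzan's inequality (41) holds at `x̂`:
  `μ(o ↔ A, x̂ ↔ b) ≤ μ(o ↔ A, o ↔ b)` (the pre-FKG inequality (3) at that relay).  Leafwise `BlobTransfer.leaf_transfer`.
* `LeafSystem.fail_le_of_leafSystem` — the general transfer with a leaf-dependent admissible designee `sel i ∈ A`:
  `μ(o ↔ A, o ↮ b) ≤ Σ_{contact leaves} μ(D i ∩ {sel i ↮ b})`.
* `LeafSystem.additiveGluing_of_leafBound` — **(SAU) ⇒ AdditiveGluing**: if every instance admits a leaf system with an admissible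
  designee whose contact-leaf failure sum is `≤ t` whenever `1 − t ≤ μ(a ↔ b)` on `A`, then `AdditiveGluing`.  (The memo's kernel (SAU)
  is this bound for the BFS system with `sel i` = the least `b`-reliable relay of `G − U i`.)
* `LeafSystem.additiveGluing_of_hereditaryRelay` — Theorem A packaged the same way (through Conjecture 1: `additiveGluing_of_knConjecture1`).
[cite: KozmaNitzan2024, Lemma 5 (p. 13), Theorem 4 (pp. 12–14), Conjecture 1 (p. 3)]
-/

namespace Summit.CriticalPhenomena.PercolationContinuityZ3.Theorems

open MeasureTheory Set
open Literature.Probability.LatticeModels (prodBernoulli)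
open Literature.Probability.Percolation
open scoped BigOperators

noncomputable section
open Classical

namespace LeafSystem

variable {V : Type*} [Fintype V]

/-- **Finite partition**: for pairwise disjoint events `D i` (finite index type) covering the space,
`μ(E) = Σ_i μ(E ∩ D i)`. [folklore] -/
theorem real_eq_sum_inter {ι : Type*} [Fintype ι] (w : Sym2 V → unitInterval) (D : ι → Set (BondConfig V))
    (hdisj : ∀ i j, i ≠ j → Disjoint (D i) (D j)) (hcover : ∀ ω, ∃ i, ω ∈ D i) (E : Set (BondConfig V)) :
    (prodBernoulli w).real E = ∑ i, (prodBernoulli w).real (E ∩ D i) := by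
  classical
  set μ := prodBernoulli w with hμ
  have hE : E = ⋃ i, (E ∩ D i) := by
    ext ω
    simp only [mem_iUnion, mem_inter_iff]
    constructor
    · intro h
      obtain ⟨i, hi⟩ := hcover ω
      exact ⟨i, h, hi⟩
    · rintro ⟨i, h, _⟩
      exact h
  have hd : Pairwise (Function.onFun Disjoint fun i => E ∩ D i) := by
    intro i j hij
    exact (hdisj i j hij).mono inter_subset_right inter_subset_right
  calc μ.real E = μ.real (⋃ i, (E ∩ D i)) := by rw [← hE]
    _ = ∑ i, μ.real (E ∩ D i) :=
        measureReal_iUnion_fintype hd (fun i => MeasurableSet.of_discrete)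

/-- **Transfer with a leaf-dependent designee.**  For a leaf system (file header) and any selection `sel i ∈ A` that is
admissible at every contact leaf (`∃ v ∈ B i`, `v ∉ U i`, `μ(sel i ↔ b in (U i)ᶜ) ≤ μ(v ↔ b in (U i)ᶜ)`):
`μ(o ↔ A, o ↮ b) ≤ Σ_{i ∈ S} μ(D i ∩ {sel i ↮ b})`, `S` = the contact leaves (those whose contact set meets `A` and misses `b`; given as any finset with that membership).
Leafwise: on `b`-leaves `o ↔ b`; on leaves missing `A ∪ {b}` the observer misses `A`; on contact leaves `BlobTransfer.leaf_transfer`.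
[cite: KozmaNitzan2024, Lemma 5 (p. 13)] -/
theorem fail_le_of_leafSystem {ι : Type*} [Fintype ι] (w : Sym2 V → unitInterval) (A : Finset V) (o b : V)
    (U B : ι → Set V) (D : ι → Set (BondConfig V)) (sel : ι → V)
    (hdisj : ∀ i j, i ≠ j → Disjoint (D i) (D j)) (hcover : ∀ ω, ∃ i, ω ∈ D i)
    (hbU : ∀ i, b ∉ U i) (hAU : ∀ i, ∀ a ∈ A, a ∉ U i)
    (hD : ∀ i, DeterminedBy (D i) {e : Sym2 V | ∃ u ∈ U i, u ∈ e})
    (hstar : ∀ i, D i ⊆ {ω | ∀ u ∈ U i, ∀ x, x ∉ U i → s(u, x) ∈ ω → x ∈ B i})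
    (hjoin : ∀ i, D i ⊆ {ω | ∀ x ∈ B i, x ∉ U i → ∃ u ∈ U i, s(u, x) ∈ ω ∧ (openGraph ω).Reachable o u})
    (hdead : ∀ i, b ∉ B i → (∀ a ∈ A, a ∉ B i) → D i ⊆ (⋃ a ∈ A, (openConn o a : Set (BondConfig V)))ᶜ)
    (hsel : ∀ i, sel i ∈ A)
    (hadm : ∀ i, b ∉ B i → (∃ a ∈ A, a ∈ B i) →
      ∃ v ∈ B i, v ∉ U i ∧ (prodBernoulli w).real (openConnIn (U i)ᶜ (sel i) b) ≤
        (prodBernoulli w).real (openConnIn (U i)ᶜ v b))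
    (S : Finset ι) (hS : ∀ i, i ∈ S ↔ (b ∉ B i ∧ ∃ a ∈ A, a ∈ B i)) :
    (prodBernoulli w).real ((⋃ a ∈ A, openConn o a) ∩ (openConn o b)ᶜ) ≤
      ∑ i ∈ S, (prodBernoulli w).real (D i ∩ (openConn (sel i) b)ᶜ) := by
  classical
  set μ := prodBernoulli w with hμ
  set OA : Set (BondConfig V) := ⋃ a ∈ A, openConn o a with hOA
  rw [real_eq_sum_inter w D hdisj hcover (OA ∩ (openConn o b)ᶜ), ← Finset.sum_add_sum_compl S]
  -- the non-contact leaves contribute 0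
  have hzero : ∑ i ∈ Sᶜ, μ.real (OA ∩ (openConn o b)ᶜ ∩ D i) = 0 := by
    refine Finset.sum_eq_zero fun i hi => ?_
    have hi' : ¬ (b ∉ B i ∧ ∃ a ∈ A, a ∈ B i) := fun h => (Finset.mem_compl.1 hi) ((hS i).2 h)
    suffices h : OA ∩ (openConn o b)ᶜ ∩ D i = ∅ by rw [h, measureReal_empty]
    rw [Set.eq_empty_iff_forall_notMem]
    rintro ω ⟨⟨hoa, hob⟩, hωD⟩
    by_cases hbB : b ∈ B i
    · -- b-leaf: o ↔ b
      obtain ⟨u, huU, hopen, hou⟩ := hjoin i hωD b hbB (hbU i)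
      have hne : u ≠ b := fun h => hbU i (h ▸ huU)
      exact hob (hou.trans ((openGraph_adj ω u b).2 ⟨hopen, hne⟩).reachable)
    · -- no relay in the contact set: o ↮ A
      have hnoA : ∀ a ∈ A, a ∉ B i := by
        intro a ha haB
        exact hi' ⟨hbB, a, ha, haB⟩
      exact hdead i hbB hnoA hωD hoa
  rw [hzero, add_zero]
  refine Finset.sum_le_sum fun i hi => ?_
  obtain ⟨hbB, x, hxA, hxB⟩ := (hS i).1 hi
  obtain ⟨v, hvB, hvU, hle⟩ := hadm i hbB ⟨x, hxA, hxB⟩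
  -- leafwise transfer: μ(OA ∩ {sel ↔ b} ∩ D) ≤ μ(OA ∩ {o ↔ b} ∩ D), hence the complement form
  have key := BlobTransfer.leaf_transfer w A (U i) (B i) (D i) o b (sel i) v x (hbU i) (hAU i _ (hsel i)) hvU hvB
    hxA hxB (hAU i x hxA) (hD i) (hstar i) (hjoin i) hle
  -- `D i ⊆ OA` (through the relay `x ∈ B i`)
  have hDOA : D i ⊆ OA := by
    intro ω hωD
    obtain ⟨u, huU, hopen, hou⟩ := hjoin i hωD x hxB (hAU i x hxA)
    have hne : u ≠ x := fun h => (hAU i x hxA) (h ▸ huU)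
    exact mem_biUnion hxA (hou.trans ((openGraph_adj ω u x).2 ⟨hopen, hne⟩).reachable)
  have hsplit : ∀ E : Set (BondConfig V), μ.real (D i) = μ.real (E ∩ D i) + μ.real (Eᶜ ∩ D i) := by
    intro E
    have := measureReal_inter_add_sdiff (μ := μ) (s := D i) (MeasurableSet.of_discrete : MeasurableSet E)
      (h := measure_ne_top _ _)
    rw [Set.sdiff_eq, inter_comm (D i) E, inter_comm (D i) Eᶜ] at this
    exact this.symm
  have e1 : OA ∩ (openConn o b)ᶜ ∩ D i = (openConn o b)ᶜ ∩ D i := by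
    ext ω; constructor
    · rintro ⟨⟨_, h1⟩, h2⟩; exact ⟨h1, h2⟩
    · rintro ⟨h1, h2⟩; exact ⟨⟨hDOA h2, h1⟩, h2⟩
  have e2 : OA ∩ openConn (sel i) b ∩ D i = openConn (sel i) b ∩ D i := by
    ext ω; constructor
    · rintro ⟨⟨_, h1⟩, h2⟩; exact ⟨h1, h2⟩
    · rintro ⟨h1, h2⟩; exact ⟨⟨hDOA h2, h1⟩, h2⟩
  have e3 : OA ∩ openConn o b ∩ D i = openConn o b ∩ D i := by
    ext ω; constructor
    · rintro ⟨⟨_, h1⟩, h2⟩; exact ⟨h1, h2⟩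
    · rintro ⟨h1, h2⟩; exact ⟨⟨hDOA h2, h1⟩, h2⟩
  rw [e2, e3] at key
  rw [e1, inter_comm (D i)]
  have h1 := hsplit (openConn o b)
  have h2 := hsplit (openConn (sel i) b)
  linarith

/-- **Theorem A (memo §2): a hereditarily admissible relay satisfies Kozma–Nitzan's (41).**  If a single relay `x̂ ∈ A` is
admissible at every contact leaf of a leaf system, then `μ(o ↔ A, x̂ ↔ b) ≤ μ(o ↔ A, o ↔ b)` — the pre-FKG inequality (3)/(41)
at `x̂` (Kozma–Nitzan Question 7/9 for this instance).  For the star system `U i = {o}` this is Kozma–Nitzan's Theorem 4.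
[cite: KozmaNitzan2024, Theorem 4 (pp. 12–14), Question 7/9 (p. 36)] -/
theorem preFKG_of_leafSystem {ι : Type*} [Fintype ι] (w : Sym2 V → unitInterval) (A : Finset V) (o b xh : V)
    (U B : ι → Set V) (D : ι → Set (BondConfig V))
    (hdisj : ∀ i j, i ≠ j → Disjoint (D i) (D j)) (hcover : ∀ ω, ∃ i, ω ∈ D i)
    (hbU : ∀ i, b ∉ U i) (hAU : ∀ i, ∀ a ∈ A, a ∉ U i)
    (hD : ∀ i, DeterminedBy (D i) {e : Sym2 V | ∃ u ∈ U i, u ∈ e})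
    (hstar : ∀ i, D i ⊆ {ω | ∀ u ∈ U i, ∀ x, x ∉ U i → s(u, x) ∈ ω → x ∈ B i})
    (hjoin : ∀ i, D i ⊆ {ω | ∀ x ∈ B i, x ∉ U i → ∃ u ∈ U i, s(u, x) ∈ ω ∧ (openGraph ω).Reachable o u})
    (hdead : ∀ i, b ∉ B i → (∀ a ∈ A, a ∉ B i) → D i ⊆ (⋃ a ∈ A, (openConn o a : Set (BondConfig V)))ᶜ)
    (hxh : xh ∈ A)
    (hadm : ∀ i, b ∉ B i → (∃ a ∈ A, a ∈ B i) →
      ∃ v ∈ B i, v ∉ U i ∧ (prodBernoulli w).real (openConnIn (U i)ᶜ xh b) ≤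
        (prodBernoulli w).real (openConnIn (U i)ᶜ v b)) :
    (prodBernoulli w).real ((⋃ a ∈ A, openConn o a) ∩ openConn xh b) ≤
      (prodBernoulli w).real ((⋃ a ∈ A, openConn o a) ∩ openConn o b) := by
  classical
  set μ := prodBernoulli w with hμ
  set OA : Set (BondConfig V) := ⋃ a ∈ A, openConn o a with hOA
  rw [real_eq_sum_inter w D hdisj hcover (OA ∩ openConn xh b), real_eq_sum_inter w D hdisj hcover (OA ∩ openConn o b)]
  refine Finset.sum_le_sum fun i _ => ?_
  by_cases hbB : b ∈ B i
  · -- b-leaf: `D i ⊆ {o ↔ b}`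
    refine measureReal_mono ?_
    rintro ω ⟨⟨hoa, _⟩, hωD⟩
    obtain ⟨u, huU, hopen, hou⟩ := hjoin i hωD b hbB (hbU i)
    have hne : u ≠ b := fun h => hbU i (h ▸ huU)
    exact ⟨⟨hoa, hou.trans ((openGraph_adj ω u b).2 ⟨hopen, hne⟩).reachable⟩, hωD⟩
  by_cases hAB : ∃ a ∈ A, a ∈ B i
  · obtain ⟨x, hxA, hxB⟩ := hAB
    obtain ⟨v, hvB, hvU, hle⟩ := hadm i hbB ⟨x, hxA, hxB⟩
    exact BlobTransfer.leaf_transfer w A (U i) (B i) (D i) o b xh v x (hbU i) (hAU i xh hxh) hvU hvB hxA hxB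
      (hAU i x hxA) (hD i) (hstar i) (hjoin i) hle
  · -- dead leaf: both sides vanish
    have hnoA : ∀ a ∈ A, a ∉ B i := fun a ha haB => hAB ⟨a, ha, haB⟩
    have h0 : OA ∩ openConn xh b ∩ D i = ∅ := by
      rw [Set.eq_empty_iff_forall_notMem]
      rintro ω ⟨⟨hoa, _⟩, hωD⟩
      exact hdead i hbB hnoA hωD hoa
    rw [h0, measureReal_empty]
    exact measureReal_nonneg

/-- **(41) at some relay implies Conjecture 1's inequality**: `μ(o ↔ A) · μ(x̂ ↔ b) ≤ μ(o ↔ b)` (Harris for the increasing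
events `{o ↔ A}`, `{x̂ ↔ b}`, then (41)). [cite: KozmaNitzan2024, Conjecture 2 ⇒ Conjecture 1 (p. 3, "by an application of the FKG inequality")] -/
theorem conj1_of_preFKG (w : Sym2 V → unitInterval) (A : Finset V) (o b xh : V)
    (h41 : (prodBernoulli w).real ((⋃ a ∈ A, openConn o a) ∩ openConn xh b) ≤
      (prodBernoulli w).real ((⋃ a ∈ A, openConn o a) ∩ openConn o b)) :
    (prodBernoulli w).real (⋃ a ∈ A, openConn o a) * (prodBernoulli w).real (openConn xh b) ≤
      (prodBernoulli w).real (openConn o b) := by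
  classical
  have hup : IsUpperSet (⋃ a ∈ A, (openConn o a : Set (BondConfig V))) := by
    intro ω ω' hle hω
    simp only [mem_iUnion, exists_prop] at hω ⊢
    obtain ⟨a, ha, h⟩ := hω
    exact ⟨a, ha, isUpperSet_openConn o a hle h⟩
  have harris := Literature.Probability.LatticeModels.prodBernoulli_harris w hup (isUpperSet_openConn xh b)
    MeasurableSet.of_discrete MeasurableSet.of_discrete
  have hmono : (prodBernoulli w).real ((⋃ a ∈ A, openConn o a) ∩ openConn o b) ≤ (prodBernoulli w).real (openConn o b) :=
    measureReal_mono inter_subset_right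
  linarith

end LeafSystem

/-- **Reduction to a failure bound.**  If for every instance with `o, b ∉ A`, `o ≠ b`, `0 ≤ t` and `1 − t ≤ μ(a ↔ b)` on `A`
one has `μ(o ↔ A, o ↮ b) ≤ t`, then `AdditiveGluing` (the placements `o ∈ A`, `o = b` are immediate and `b ∈ A` reduces to
`A ∖ {b}`, where `{o ↔ A} ∖ {o ↔ b} = {o ↔ A ∖ b} ∖ {o ↔ b}`). [folklore] -/
theorem LeafSystem.additiveGluing_of_failBound
    (hF : ∀ (n : ℕ) (w : Sym2 (Fin n) → unitInterval) (A : Finset (Fin n)) (o b : Fin n) (t : ℝ),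
      o ∉ A → b ∉ A → o ≠ b → 0 ≤ t → (∀ a ∈ A, 1 - t ≤ (prodBernoulli w).real (openConn a b)) →
      (prodBernoulli w).real ((⋃ a ∈ A, openConn o a) ∩ (openConn o b)ᶜ) ≤ t) :
    Theses.PercNearOneGluing.AdditiveGluing := by
  classical
  intro n w A o b t ht hrel
  set μ := prodBernoulli w with hμ
  set OA : Set (BondConfig (Fin n)) := ⋃ a ∈ A, openConn o a with hOA
  have hsplit : μ.real OA = μ.real (OA ∩ openConn o b) + μ.real (OA ∩ (openConn o b)ᶜ) := by
    rw [← measureReal_inter_add_sdiff (s := OA) (MeasurableSet.of_discrete : MeasurableSet (openConn o b : Set _))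
      (h := measure_ne_top _ _), Set.sdiff_eq]
  have hle1 : μ.real (OA ∩ openConn o b) ≤ μ.real (openConn o b) := measureReal_mono inter_subset_right
  by_cases hoA : o ∈ A
  · have h1 := hrel o hoA
    have h2 : μ.real OA ≤ 1 := measureReal_le_one
    linarith
  by_cases hob : o = b
  · subst hob
    have h1 : μ.real (openConn o o : Set (BondConfig (Fin n))) = 1 := by
      have : (openConn o o : Set (BondConfig (Fin n))) = univ := by
        ext ω; exact ⟨fun _ => trivial, fun _ => SimpleGraph.Reachable.refl _⟩
      rw [this]; exact probReal_univ
    have h2 : μ.real OA ≤ 1 := measureReal_le_one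
    linarith
  by_cases hbA : b ∈ A
  · set A' := A.erase b with hA'
    have hrel' : ∀ a ∈ A', 1 - t ≤ μ.real (openConn a b) := fun a ha => hrel a (Finset.mem_of_mem_erase ha)
    have hoA' : o ∉ A' := fun h => hoA (Finset.mem_of_mem_erase h)
    have hbA' : b ∉ A' := Finset.notMem_erase b A
    have hfail := hF n w A' o b t hoA' hbA' hob ht hrel'
    have heq : OA ∩ (openConn o b)ᶜ = (⋃ a ∈ A', (openConn o a : Set (BondConfig (Fin n)))) ∩ (openConn o b)ᶜ := by
      ext ω
      simp only [hOA, hA', mem_inter_iff, mem_iUnion, mem_compl_iff, exists_prop, Finset.mem_erase]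
      constructor
      · rintro ⟨⟨a, ha, hoa⟩, hnob⟩
        refine ⟨⟨a, ⟨?_, ha⟩, hoa⟩, hnob⟩
        rintro rfl; exact hnob hoa
      · rintro ⟨⟨a, ⟨_, ha⟩, hoa⟩, hnob⟩
        exact ⟨⟨a, ha, hoa⟩, hnob⟩
    rw [heq] at hsplit
    linarith
  have hfail := hF n w A o b t hoA hbA hob ht hrel
  linarith

/-- **(SAU) ⇒ `AdditiveGluing`** (memo §3).  Hypothesis: every instance `(w, A, o, b, t)` with `o, b ∉ A`, `o ≠ b`, `0 ≤ t` and
`1 − t ≤ μ(a ↔ b)` on `A` admits a leaf system with an admissible designee `sel` whose contact-leaf failure sum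
`Σ_{contact i} μ(D i ∩ {sel i ↮ b})` is at most `t`.  Conclusion: the crux decl.  (The memo's kernel (SAU) is this bound for the
BFS leaf system with `sel i` = the least `b`-reliable relay of `G − U i`, using `max_a μ(a ↮ b) ≤ t`.)
[cite: KozmaNitzan2024, Lemma 5 (p. 13)] -/
theorem LeafSystem.additiveGluing_of_leafBound
    (hSAU : ∀ (n : ℕ) (w : Sym2 (Fin n) → unitInterval) (A : Finset (Fin n)) (o b : Fin n) (t : ℝ),
      o ∉ A → b ∉ A → o ≠ b → 0 ≤ t → (∀ a ∈ A, 1 - t ≤ (prodBernoulli w).real (openConn a b)) →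
      ∃ (ι : Type) (_ : Fintype ι) (U B : ι → Set (Fin n)) (D : ι → Set (BondConfig (Fin n))) (sel : ι → Fin n),
        (∀ i j, i ≠ j → Disjoint (D i) (D j)) ∧ (∀ ω, ∃ i, ω ∈ D i) ∧ (∀ i, b ∉ U i) ∧ (∀ i, ∀ a ∈ A, a ∉ U i) ∧
        (∀ i, DeterminedBy (D i) {e : Sym2 (Fin n) | ∃ u ∈ U i, u ∈ e}) ∧
        (∀ i, D i ⊆ {ω | ∀ u ∈ U i, ∀ x, x ∉ U i → s(u, x) ∈ ω → x ∈ B i}) ∧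
        (∀ i, D i ⊆ {ω | ∀ x ∈ B i, x ∉ U i → ∃ u ∈ U i, s(u, x) ∈ ω ∧ (openGraph ω).Reachable o u}) ∧
        (∀ i, b ∉ B i → (∀ a ∈ A, a ∉ B i) → D i ⊆ (⋃ a ∈ A, (openConn o a : Set (BondConfig (Fin n))))ᶜ) ∧
        (∀ i, sel i ∈ A) ∧
        (∀ i, b ∉ B i → (∃ a ∈ A, a ∈ B i) → ∃ v ∈ B i, v ∉ U i ∧
          (prodBernoulli w).real (openConnIn (U i)ᶜ (sel i) b) ≤ (prodBernoulli w).real (openConnIn (U i)ᶜ v b)) ∧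
        (∑ i ∈ (Finset.univ : Finset ι).filter (fun i => b ∉ B i ∧ ∃ a ∈ A, a ∈ B i),
          (prodBernoulli w).real (D i ∩ (openConn (sel i) b)ᶜ)) ≤ t) :
    Theses.PercNearOneGluing.AdditiveGluing := by
  classical
  refine LeafSystem.additiveGluing_of_failBound fun n w A o b t hoA hbA hob ht hrel => ?_
  obtain ⟨ι, hι, U, B, D, sel, hdisj, hcover, hbU, hAU, hD, hstar, hjoin, hdead, hsel, hadm, hsum⟩ :=
    hSAU n w A o b t hoA hbA hob ht hrel
  exact (LeafSystem.fail_le_of_leafSystem w A o b U B D sel hdisj hcover hbU hAU hD hstar hjoin hdead hsel hadm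
    _ (fun i => by rw [Finset.mem_filter]; exact ⟨fun h => h.2, fun h => ⟨Finset.mem_univ i, h⟩⟩)).trans hsum

/-- **Theorem A, packaged for the crux**: if every instance with `o, b ∉ A`, `o ≠ b`, `A ≠ ∅` admits a leaf system in which ONE
relay `x̂ ∈ A` is admissible at every contact leaf, then `AdditiveGluing`: by `preFKG_of_leafSystem`, (41) holds at `x̂`; by Harris
`μ(o ↔ A, x̂ ↔ b) ≥ μ(o ↔ A)·μ(x̂ ↔ b)`; so `μ(o ↔ A, o ↮ b) ≤ μ(o ↔ A)(1 − μ(x̂ ↔ b)) ≤ t`.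
[cite: KozmaNitzan2024, Theorem 4 (pp. 12–14), Conjecture 2 ⇒ 1 (p. 3)] -/
theorem LeafSystem.additiveGluing_of_hereditaryRelay
    (hA : ∀ (n : ℕ) (w : Sym2 (Fin n) → unitInterval) (A : Finset (Fin n)) (o b : Fin n),
      o ∉ A → b ∉ A → o ≠ b → A.Nonempty →
      ∃ (ι : Type) (_ : Fintype ι) (U B : ι → Set (Fin n)) (D : ι → Set (BondConfig (Fin n))) (xh : Fin n),
        (∀ i j, i ≠ j → Disjoint (D i) (D j)) ∧ (∀ ω, ∃ i, ω ∈ D i) ∧ (∀ i, b ∉ U i) ∧ (∀ i, ∀ a ∈ A, a ∉ U i) ∧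
        (∀ i, DeterminedBy (D i) {e : Sym2 (Fin n) | ∃ u ∈ U i, u ∈ e}) ∧
        (∀ i, D i ⊆ {ω | ∀ u ∈ U i, ∀ x, x ∉ U i → s(u, x) ∈ ω → x ∈ B i}) ∧
        (∀ i, D i ⊆ {ω | ∀ x ∈ B i, x ∉ U i → ∃ u ∈ U i, s(u, x) ∈ ω ∧ (openGraph ω).Reachable o u}) ∧
        (∀ i, b ∉ B i → (∀ a ∈ A, a ∉ B i) → D i ⊆ (⋃ a ∈ A, (openConn o a : Set (BondConfig (Fin n))))ᶜ) ∧
        xh ∈ A ∧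
        (∀ i, b ∉ B i → (∃ a ∈ A, a ∈ B i) → ∃ v ∈ B i, v ∉ U i ∧
          (prodBernoulli w).real (openConnIn (U i)ᶜ xh b) ≤ (prodBernoulli w).real (openConnIn (U i)ᶜ v b))) :
    Theses.PercNearOneGluing.AdditiveGluing := by
  classical
  refine LeafSystem.additiveGluing_of_failBound fun n w A o b t hoA hbA hob ht hrel => ?_
  set μ := prodBernoulli w with hμ
  set OA : Set (BondConfig (Fin n)) := ⋃ a ∈ A, openConn o a with hOA
  by_cases hAe : A = ∅
  · have h0 : OA ∩ (openConn o b)ᶜ = ∅ := by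
      ext ω; simp [hOA, hAe]
    rw [h0, measureReal_empty]; exact ht
  obtain ⟨ι, hι, U, B, D, xh, hdisj, hcover, hbU, hAU, hD, hstar, hjoin, hdead, hxh, hadm⟩ :=
    hA n w A o b hoA hbA hob (Finset.nonempty_iff_ne_empty.2 hAe)
  have h41 := LeafSystem.preFKG_of_leafSystem w A o b xh U B D hdisj hcover hbU hAU hD hstar hjoin hdead hxh hadm
  -- Harris: μ(o ↔ A) μ(x̂ ↔ b) ≤ μ(o ↔ A, x̂ ↔ b)
  have hup : IsUpperSet OA := by
    intro ω ω' hle hω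
    simp only [hOA, mem_iUnion, exists_prop] at hω ⊢
    obtain ⟨a, ha, h⟩ := hω
    exact ⟨a, ha, isUpperSet_openConn o a hle h⟩
  have harris := Literature.Probability.LatticeModels.prodBernoulli_harris w hup (isUpperSet_openConn xh b)
    MeasurableSet.of_discrete MeasurableSet.of_discrete
  have hsplit : μ.real OA = μ.real (OA ∩ openConn o b) + μ.real (OA ∩ (openConn o b)ᶜ) := by
    rw [← measureReal_inter_add_sdiff (s := OA) (MeasurableSet.of_discrete : MeasurableSet (openConn o b : Set _))
      (h := measure_ne_top _ _), Set.sdiff_eq]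
  have hx := hrel xh hxh
  have hOA1 : μ.real OA ≤ 1 := measureReal_le_one
  have hOA0 : 0 ≤ μ.real OA := measureReal_nonneg
  -- μ(OA ∩ (ob)ᶜ) = μ(OA) − μ(OA ∩ ob) ≤ μ(OA) − μ(OA) μ(x̂ ↔ b) ≤ μ(OA)·t ≤ t
  nlinarith [mul_le_mul_of_nonneg_left hx hOA0]

/-- **(SAU)-type bound ⇒ `AdditiveGluing`, with the non-emptiness guard.**  As `LeafSystem.additiveGluing_of_leafBound`, but the leaf
system with an admissible designee is only required for instances with `A ≠ ∅` (for `A = ∅` the designee condition `sel i ∈ A` is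
unsatisfiable, so the unguarded hypothesis could not be discharged; this is the form to use). [cite: KozmaNitzan2024, Lemma 5 (p. 13)] -/
theorem LeafSystem.additiveGluing_of_leafBound'
    (hSAU : ∀ (n : ℕ) (w : Sym2 (Fin n) → unitInterval) (A : Finset (Fin n)) (o b : Fin n) (t : ℝ),
      o ∉ A → b ∉ A → o ≠ b → A.Nonempty → 0 ≤ t → (∀ a ∈ A, 1 - t ≤ (prodBernoulli w).real (openConn a b)) →
      ∃ (ι : Type) (_ : Fintype ι) (U B : ι → Set (Fin n)) (D : ι → Set (BondConfig (Fin n))) (sel : ι → Fin n),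
        (∀ i j, i ≠ j → Disjoint (D i) (D j)) ∧ (∀ ω, ∃ i, ω ∈ D i) ∧ (∀ i, b ∉ U i) ∧ (∀ i, ∀ a ∈ A, a ∉ U i) ∧
        (∀ i, DeterminedBy (D i) {e : Sym2 (Fin n) | ∃ u ∈ U i, u ∈ e}) ∧
        (∀ i, D i ⊆ {ω | ∀ u ∈ U i, ∀ x, x ∉ U i → s(u, x) ∈ ω → x ∈ B i}) ∧
        (∀ i, D i ⊆ {ω | ∀ x ∈ B i, x ∉ U i → ∃ u ∈ U i, s(u, x) ∈ ω ∧ (openGraph ω).Reachable o u}) ∧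
        (∀ i, b ∉ B i → (∀ a ∈ A, a ∉ B i) → D i ⊆ (⋃ a ∈ A, (openConn o a : Set (BondConfig (Fin n))))ᶜ) ∧
        (∀ i, sel i ∈ A) ∧
        (∀ i, b ∉ B i → (∃ a ∈ A, a ∈ B i) → ∃ v ∈ B i, v ∉ U i ∧
          (prodBernoulli w).real (openConnIn (U i)ᶜ (sel i) b) ≤ (prodBernoulli w).real (openConnIn (U i)ᶜ v b)) ∧
        (∑ i ∈ (Finset.univ : Finset ι).filter (fun i => b ∉ B i ∧ ∃ a ∈ A, a ∈ B i),
          (prodBernoulli w).real (D i ∩ (openConn (sel i) b)ᶜ)) ≤ t) :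
    Theses.PercNearOneGluing.AdditiveGluing := by
  classical
  refine LeafSystem.additiveGluing_of_failBound fun n w A o b t hoA hbA hob ht hrel => ?_
  by_cases hAe : A = ∅
  · have h0 : (⋃ a ∈ A, (openConn o a : Set (BondConfig (Fin n)))) ∩ (openConn o b)ᶜ = ∅ := by
      ext ω; simp [hAe]
    rw [h0, measureReal_empty]; exact ht
  obtain ⟨ι, hι, U, B, D, sel, hdisj, hcover, hbU, hAU, hD, hstar, hjoin, hdead, hsel, hadm, hsum⟩ :=
    hSAU n w A o b t hoA hbA hob (Finset.nonempty_iff_ne_empty.2 hAe) ht hrel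
  exact (LeafSystem.fail_le_of_leafSystem w A o b U B D sel hdisj hcover hbU hAU hD hstar hjoin hdead hsel hadm
    _ (fun i => by rw [Finset.mem_filter]; exact ⟨fun h => h.2, fun h => ⟨Finset.mem_univ i, h⟩⟩)).trans hsum

end

end Summit.CriticalPhenomena.PercolationContinuityZ3.Theorems
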